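import Summits.SmoothPoincare4.SmoothPoincare4.Theses.MinimalSphereMeanConvex
import HarnessLib

/-!
# Line `birth` — BC3 skeleton for the crux `RicciPositiveMinimalSphere` (stmt-SmoothPoincare4-5486)

Route `MinimalSphereMeanConvex` (route-SmoothPoincare4-MinimalSphereMeanConvex), crux M1 (rank 3), decl
`Summit.SmoothPoincare4.SmoothPoincare4.Theses.MinimalSphereMeanConvex.RicciPositiveMinimalSphere`:

  every homotopy 4-sphere `Σ` carries a `C^∞` Riemannian metric `g` (with its Levi-Civita connection)
  of POSITIVE RICCI CURVATURE together with an EMBEDDED, TWO-SIDED, MINIMAL 3-SPHERE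
  (`f : S³ → Σ` an injective spacelike immersion, `ν` a smooth unit normal field along `f`,
  `IsMaximalSlice` = vanishing mean curvature `tr_{f^*g} K_ν = 0`).

## The line = the route header's own two-layer plan for M1, typed

Route header, TWO-LAYER PLAN: "M1 ⇐ RicciPositiveMetric → MinimalSphereInRicciPositive (a Ric > 0
homotopy 4-sphere contains an embedded minimal S³ — the Simon–Smith sphere theorem one dimension up, or
min-max with topological control) → M1". The crux bundles two logically independent open problems, one
about smooth structures (curvature on a possibly exotic `Σ`) and one of pure geometric analysis
(topology of minimal hypersurfaces for a GIVEN metric); the line cuts exactly there: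

* `stub_ricciPositiveMetric` (`Sig.stub_ricciPositiveMetric`) — **OPEN (differential topology /
  curvature):** every homotopy 4-sphere carries a Riemannian metric with `Ric > 0`. This is VERBATIM
  the route's own rank-5 crux `RicciPositiveMetric` (item stmt-SmoothPoincare4-5487;
  `Sig.stub_ricciPositiveMetric_iff` records the identity by `Iff.rfl`), and one mathematical statement
  with `InstantonEntropy.ExistRicPos` (stmt-SmoothPoincare4-11180, bare-`M` form), whose registered line
  `Cruxes/ExistRicPos/Lines/birth.lean` (Chang–Gursky–Yang σ₂-conformal route: a PSC metric with
  `∫σ₂(A) > 0`, i.e. Weyl energy `< 64π²`, ⇒ `Ric > 0`) is therefore a plan for this stub too.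
  Implied by `SPC4` (pull back the round metric). Why it might fail: `Σ ≠ S⁴` arises from `S⁴` only
  by codimension-2 moves (Gluck regluing, h-cobordisms) where `Ric > 0` surgery (codim ≥ 3, Sha–Yang
  1991, Wraith 1998) is silent; even PSC on an exotic `Σ` is open (Kumar–Sen 2025).
* `stub_minimalSphereOfRicciPositive` (`Sig.stub_minimalSphereOfRicciPositive`) — **OPEN (geometric
  analysis), the hardest / load-bearing stub:** for EVERY homotopy 4-sphere `Σ` and EVERY Riemannian
  metric `g` on it with `Ric > 0` there is an embedded two-sided minimal 3-sphere (the crux's last four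
  clauses verbatim, for the given `g`). This is "Simon–Smith one dimension up": Smith 1982 / Simon–Smith
  give an embedded minimal `S²` in every `(S³, g)`, Haslhofer–Ketover 2019 (arXiv:1708.06567) two of them
  when `Ric > 0`; in ambient dimension 4 Almgren–Pitts min-max (Pitts 1981, Schoen–Simon 1981; in
  `Ric > 0`: Zhou 2015 = ZhouMinMaxRicci2015 — the width is realised by an index-1 two-sided hypersurface
  of multiplicity one or a one-sided one of multiplicity two; Marques–Neves 2017; multiplicity one,
  Zhou 2020 arXiv:1901.01173) produces a smooth closed embedded minimal hypersurface (`3 < 7`) with NO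
  control of its topology — the genus bound of Simon–Smith has no 3-dimensional substitute. Already for
  `Σ = S⁴` with an arbitrary `Ric > 0` metric the statement is open (to our knowledge), and it involves no
  exotic smooth structure at all: it is NOT the crux or the summit in disguise (`SPC4` does not imply it).
  Why it might fail: a `Ric > 0` metric on `S⁴` all of whose embedded minimal hypersurfaces have
  `b₁ + #(prime summands) ≥ 1` (e.g. only `S¹×S²`-type and connected sums realise the low widths) would
  refute it while leaving the crux open (the crux needs ONE good metric, the stub serves ALL).
* `RicciPositiveMinimalSphere_of : Sig.stub_ricciPositiveMetric → Sig.stub_minimalSphereOfRicciPositive →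
  RicciPositiveMinimalSphere` — the composition (sorry-free; modus ponens: take the metric of stub 1, feed
  it to stub 2), concluding the route decl BY NAME; `RicciPositiveMinimalSphere_proof` is the skeleton in
  its final shape (depends on `sorryAx` only through the two `stub_*`). The seam is deliberately trivial
  (`trivial_seam`): the content is the orthogonality of the two stubs (smooth topology ∥ geometric
  analysis), each attackable and refutable on its own.

Alternative cuts considered and NOT registered here (left to crux-ideate): (i) min-max split of stub 2
into the KNOWN existence of an index-1 two-sided embedded minimal hypersurface realising the width
(Zhou 2015/2020) plus the rigidity claim "index 1 in a `Ric > 0` homotopy 4-sphere ⇒ `≅ S³`" — the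
rigidity half is dubious (one dimension down, index-1 minimal surfaces in `Ric > 0` 3-spheres may have
genus up to 3) and is not needed by the route; (ii) the doubling/gluing cut "every contractible smooth
4-manifold bounded by `S³` (the two halves of `Σ` along any embedded `S³`) carries `Ric > 0` with minimal
or totally geodesic round boundary" + a Perelman-type `Ric > 0` gluing lemma — a different mechanism
(it plants the minimal sphere by construction instead of finding it), to be carded separately.

## Disproof used / negatives

No `Cruxes/RicciPositiveMinimalSphere/Disproof.lean` exists at registration (`ledger crux ls
stmt-SmoothPoincare4-5486`: no workfiles, 2026-08-17); `ledger negatives --problem SmoothPoincare4`: 0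
refuted statements; no landed `Theorems/RicciPositiveMinimalSphere/Negative/*`. Nothing to honour yet.
Item evidence (grounder g18-7, refuter route-review 2026-08-15): crux OPEN; "min-max gives no topology
control" — which is exactly what stub 2 isolates.

## BC3 audit (this seat, planner-skel-stmt-SmoothPoincare4-5486-0, 2026-08-17; raw outputs in the seat's
NOTES.md `birth-certificate:` and in `Lines/birth.md`)

`lean check --json` of this file: rc 0, `sorries` = 2 = stub count (the two `stub_*` declarations, zero
elsewhere); `#print axioms RicciPositiveMinimalSphere_of` = [propext, Classical.choice, Quot.sound]; audit:
`RicciPositiveMinimalSphere_of` "proves …Theses.MinimalSphereMeanConvex.RicciPositiveMinimalSphere only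
under unregistered hypotheses [Sig.stub_ricciPositiveMetric, Sig.stub_minimalSphereOfRicciPositive]",
`RicciPositiveMinimalSphere_proof` "proof-of-item … NOT closed: axioms [sorryAx]". Probes (seat folder
`bc/probe_stub{1,2}_{crux,summit}.lean`: route file + ONE plain `def Sig.stub_*` each, no sorried theorem
in scope): `example : Sig.stub → RicciPositiveMinimalSphere` and `example : Sig.stub → _root_.SmoothPoincare4`
by `first | exact? | simpa [Sig.stub] | (unfold Sig.stub; simpa) | aesop` under `maxHeartbeats 400000`
FAIL 4/4 (rc 1: stub 1 — "unsolved goals ⊢ RicciPositiveMinimalSphere" / "⊢ SmoothPoincare4" after aesop's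
exhaustive search; stub 2 — heartbeat cap reached inside the `first` block); split per tactic
(`bc/probe_*_split.lean`, tactics `exact?` · `simpa [Sig]` · `unfold; simpa` · `aesop` · `intro h; exact?`):
20/20 FAIL — `exact?`: "could not close the goal" (8/8), `simpa`: "Tactic `assumption` failed" on the
unfolded implication (8/8), `aesop`: "failed to prove the goal after exhaustive search" (4/4). No stub is
cheaply the crux or the summit.
-/

set_option linter.dupNamespace false
set_option linter.unusedVariables false

noncomputable section

namespace Summit.SmoothPoincare4.SmoothPoincare4.Cruxes.RicciPositiveMinimalSphere.Birth

open scoped Manifold ContDiff Topology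
open Literature.Geometry.Lorentzian (PseudoRiemannianMetric NormalField)
open Literature.Topology.FourManifolds (HomotopySphere)
open Summit.SmoothPoincare4.SmoothPoincare4.Theses.MinimalSphereMeanConvex

/-- Local notation: the model space `ℝ⁴`. -/
local notation "ℝ⁴" => EuclideanSpace ℝ (Fin 4)
/-- Local notation: the round unit `S³ ⊂ ℝ⁴` (the data manifold of the embedded sphere). -/
local notation "𝕊³" => (Metric.sphere (0 : EuclideanSpace ℝ (Fin 4)) 1)

/-! ### Stub signatures (`Sig.stub_*`, so that the hypothesis heads of `RicciPositiveMinimalSphere_of`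
carry the registered stub names) -/

/-- STUB 1 — A `Ric > 0` METRIC ON EVERY HOMOTOPY 4-SPHERE (verbatim the route item
`RicciPositiveMetric`, stmt-SmoothPoincare4-5487; same mathematics as `InstantonEntropy.ExistRicPos`,
stmt-SmoothPoincare4-11180). For every homotopy 4-sphere `S` there is a `C^∞` Riemannian metric `g` on
`T S.carrier` with its Levi-Civita connection and `Ric_g(v,v) > 0` for every non-zero tangent vector. -/
def Sig.stub_ricciPositiveMetric : Prop :=
  ∀ S : HomotopySphere 4,
    ∃ g : PseudoRiemannianMetric (𝓡 4) ∞ ℝ⁴ (TangentSpace (𝓡 4) : S.carrier → Type _),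
      ∃ _ : g.HasLeviCivita, g.IsRiemannian ∧
        ∀ x (v : TangentSpace (𝓡 4) x), v ≠ 0 → 0 < g.ricci x v v

/-- Stub 1 IS the route item `RicciPositiveMetric` (stmt-SmoothPoincare4-5487), definitionally. -/
theorem Sig.stub_ricciPositiveMetric_iff : Sig.stub_ricciPositiveMetric ↔ RicciPositiveMetric :=
  Iff.rfl

/-- STUB 2 — SIMON–SMITH ONE DIMENSION UP, IN POSITIVE RICCI CURVATURE (the route header's
`MinimalSphereInRicciPositive`). For every homotopy 4-sphere `S` and EVERY `C^∞` Riemannian metric `g`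
on it (Levi-Civita connection as the standing instance) with `Ric > 0`, there is an embedded two-sided
minimal 3-sphere: an injective spacelike immersion `f : S³ → S.carrier`, a unit normal field `ν` along
`f` which is smooth as a map into `T S.carrier`, with vanishing mean curvature (`IsMaximalSlice`). -/
def Sig.stub_minimalSphereOfRicciPositive : Prop :=
  ∀ (S : HomotopySphere 4)
    (g : PseudoRiemannianMetric (𝓡 4) ∞ ℝ⁴ (TangentSpace (𝓡 4) : S.carrier → Type _))
    [g.HasLeviCivita], g.IsRiemannian →
      (∀ x (v : TangentSpace (𝓡 4) x), v ≠ 0 → 0 < g.ricci x v v) →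
        ∃ (f : 𝕊³ → S.carrier) (hf : g.IsSpacelikeImmersion (𝓡 3) f) (ν : NormalField (𝓡 4) f),
          Function.Injective f ∧ g.IsUnitNormal (𝓡 3) f ν 1 ∧
            ContMDiff (𝓡 3) (𝓡 4).tangent ∞
              (fun y ↦ (Bundle.TotalSpace.mk' ℝ⁴ (f y) (ν y) : TangentBundle (𝓡 4) S.carrier)) ∧
            g.IsMaximalSlice f PseudoRiemannianMetric.contMDiff_pullbackBilin_holds hf ν

/-! ### The two registered stubs (`sorry` lives ONLY here) -/

/-- Registered stub 1 (smooth-topology half: `Ric > 0` on every homotopy 4-sphere; = item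
stmt-SmoothPoincare4-5487). Sources: ShaYang1991, Wraith1998, KumarSen2025, Hamilton1997,
GromovLawson1980; plan: `Cruxes/ExistRicPos/Lines/birth.lean` (ChangGurskyYang2002 Thm A / Cor B). -/
theorem stub_ricciPositiveMetric : Sig.stub_ricciPositiveMetric := by
  sorry

/-- Registered stub 2 (geometric-analysis half, load-bearing and hardest: every `Ric > 0` metric on a
homotopy 4-sphere has an embedded two-sided minimal `S³`). Sources: ZhouMinMaxRicci2015 (Thm 1.1),
MarquesNeves2017, HaslhoferKetover2019 (arXiv:1708.06567, the `n = 2` model), Smith 1982 (thesis) /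
Simon–Smith, Zhou 2020 (arXiv:1901.01173, multiplicity one), Frankel1966. -/
theorem stub_minimalSphereOfRicciPositive : Sig.stub_minimalSphereOfRicciPositive := by
  sorry

/-! ### Composition (no `sorry` below this line) -/

/-- **The line closes the crux BY NAME modulo the two registered stubs.** Given a homotopy 4-sphere
`S`, stub 1 supplies `g` with its Levi-Civita instance, `IsRiemannian` and `Ric > 0`; stub 2, applied to
that `g`, supplies the embedded two-sided minimal 3-sphere `(f, hf, ν)`; the crux is the conjunction.
[bookkeeping] -/
theorem RicciPositiveMinimalSphere_of :
    Sig.stub_ricciPositiveMetric → Sig.stub_minimalSphereOfRicciPositive →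
      RicciPositiveMinimalSphere := by
  intro h₁ h₂ S
  obtain ⟨g, hLC, hRiem, hRic⟩ := h₁ S
  obtain ⟨f, hf, ν, hinj, hunit, hνs, hmin⟩ := h₂ S g hRiem hRic
  exact ⟨g, hLC, hRiem, hRic, f, hf, ν, hinj, hunit, hνs, hmin⟩

/-- The skeleton in its final shape: the crux BY NAME from the two registered stubs; it becomes the crux
proof when the last `stub_*` is discharged (until then it depends on `sorryAx` through the stubs only —
no `sorry` of its own). -/
theorem RicciPositiveMinimalSphere_proof : RicciPositiveMinimalSphere :=
  RicciPositiveMinimalSphere_of stub_ricciPositiveMetric stub_minimalSphereOfRicciPositive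

end Summit.SmoothPoincare4.SmoothPoincare4.Cruxes.RicciPositiveMinimalSphere.Birth

end
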